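import Summits.ValiantsHypothesis.ValiantsHypothesis.Theorems.BarrierLeverChowThinRowsSubcubePrelims

/-!
# Route BarrierLever — item `ChowHitsThinRowPartitionMinors` (stmt-ValiantsHypothesis-20195):
# the leave-one-out products over a power set are a BASIS (prelims for the sub-cube slice, II)

Helper file (`--supports stmt-ValiantsHypothesis-20195`; cell valiant-natproofs, rung V4, 𝒟-side of
door (c); prover seat valiant-natproofs-prover gen 10).  Closes NO item; imports only
`…ChowThinRowsSubcubePrelims` (no route file).  Conventions as there.

* `leaveOneOut_independent` — for the `2^{|T|}` indicator forms `φ⁰_V = 1 + Σ_{c ∈ V} y_c`, `V ⊆ T`,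
  the leave-one-out products `E_V = ∏_{V' ≠ V} φ⁰_{V'}` have LINEARLY INDEPENDENT coefficient vectors
  on the squarefree monomials `y^W`, `W ⊆ T` (so, being `2^{|T|}` vectors in `ℂ^{2^T}`, a basis).
  Mechanism: `E_V = B · t_V` (`coeff_leaveOneOut`), the truncated inverses `t_V` are triangular in
  the containment order, and `B(∅) = 1` — a planted, genericity-free instance of the «leave-one-out
  MDS / SPARK» statement of planner g14's MEMO-thinrows §10;
* `coeff_empty_prod_nat` — the `x`-free coefficients of a product of indicator forms are natural
  numbers, `≥ 1` at `y^W` once all singletons `{c}`, `c ∈ W`, are among the forms;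
* `exists_forms_of_card_le` — distributing `≤ h + h` affine forms over the slots `Fin (h + h)`;
* `det_one_updateRow` — the identity matrix with one row replaced has determinant the diagonal
  entry of that row (matrix determinant lemma).

WHAT THIS IS NOT: nothing here on items 20195 / 20172 / 19717 themselves, on crux
stmt-ValiantsHypothesis-14610, or on `VP` versus `VNP`.
-/

set_option linter.dupNamespace false

namespace Summit.ValiantsHypothesis.ValiantsHypothesis.Theorems.BarrierLever.ChowSubcube

open Finset MvPolynomial
open Summit.ValiantsHypothesis.ValiantsHypothesis.Theorems.BarrierLever.ChowFactor
  (coeff_partitionExpo_mul_affine coeff_partitionExpo_mul_yOnly totalDegree_affine_le)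
open Summit.ValiantsHypothesis.ValiantsHypothesis.Theorems.BarrierLever.ProductStateSums
  (castAdd_ne_natAdd partitionExpo_apply_castAdd partitionExpo_apply_natAdd)
open Summit.ValiantsHypothesis.ValiantsHypothesis.Theorems.BarrierLever.CorankRepair (partitionExpo_eq_iff)

variable {h : ℕ}

/-! ## 3. The leave-one-out products over a full power set are linearly independent -/

/-- **Linear independence of the leave-one-out products** `E_V = ∏_{V' ⊆ T, V' ≠ V} φ⁰_{V'}`
(`V ⊆ T`) on the squarefree monomials `y^W`, `W ⊆ T`: a vanishing combination has all
coefficients zero.  Mechanism: `E_V = B · t_V` and the `t_V` are triangular in the containment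
order, `B` has constant term `1`. -/
theorem leaveOneOut_independent (T : Finset (Fin h)) (cV : Finset (Fin h) → ℂ)
    (hc : ∀ W ∈ T.powerset, ∑ V ∈ T.powerset, cV V *
      coeff (∑ a ∈ (∅ : Finset (Fin h)), Finsupp.single (Fin.castAdd h a) 1 +
          ∑ c ∈ W, Finsupp.single (Fin.natAdd h c) 1)
        (∏ V' ∈ T.powerset.erase V, (C 1 + ∑ a, C ((fun (_ : Fin h) (_ : Finset (Fin h)) => (0 : ℂ)) a V') *
          X (Fin.castAdd h a) + ∑ c, C (if c ∈ V' then (1 : ℂ) else 0) * X (Fin.natAdd h c))) = 0) :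
    ∀ V ∈ T.powerset, cV V = 0 := by
  classical
  -- abbreviations: the full product `B`, its coefficients, the dual combination `d`
  set B : MvPolynomial (Fin (h + h)) ℂ := ∏ V' ∈ T.powerset,
    (C 1 + ∑ a, C ((fun (_ : Fin h) (_ : Finset (Fin h)) => (0 : ℂ)) a V') * X (Fin.castAdd h a) +
      ∑ c, C (if c ∈ V' then (1 : ℂ) else 0) * X (Fin.natAdd h c)) with hB
  set b : Finset (Fin h) → ℂ := fun X' => coeff (∑ a ∈ (∅ : Finset (Fin h)),
    Finsupp.single (Fin.castAdd h a) 1 + ∑ c ∈ X', Finsupp.single (Fin.natAdd h c) 1) B with hb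
  set d : Finset (Fin h) → ℂ := fun U => ((-1 : ℂ) ^ U.card * (U.card.factorial : ℂ)) *
    ∑ V ∈ T.powerset with U ⊆ V, cV V with hd
  have hb0 : b ∅ = 1 := by
    simp only [hb, hB]
    exact coeff_empty_empty_prod _ _
  -- Step 0: rewrite the hypothesis as `Σ_{U ⊆ W} b (W \ U) · d U = 0`
  have hconv : ∀ W ∈ T.powerset, ∑ U ∈ W.powerset, b (W \ U) * d U = 0 := by
    intro W hW
    have e := hc W hW
    have hrow : ∀ V ∈ T.powerset, cV V *
        coeff (∑ a ∈ (∅ : Finset (Fin h)), Finsupp.single (Fin.castAdd h a) 1 +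
            ∑ c ∈ W, Finsupp.single (Fin.natAdd h c) 1)
          (∏ V' ∈ T.powerset.erase V, (C 1 + ∑ a, C ((fun (_ : Fin h) (_ : Finset (Fin h)) => (0 : ℂ)) a V') *
            X (Fin.castAdd h a) + ∑ c, C (if c ∈ V' then (1 : ℂ) else 0) * X (Fin.natAdd h c))) =
        ∑ U ∈ W.powerset, cV V * (b (W \ U) *
          if U ⊆ V then (-1 : ℂ) ^ U.card * (U.card.factorial : ℂ) else 0) := by
      intro V hV
      rw [coeff_leaveOneOut _ V hV W, Finset.mul_sum]
      refine Finset.sum_congr rfl fun U _ => ?_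
      rw [coeff_tinv]
    rw [Finset.sum_congr rfl hrow, Finset.sum_comm] at e
    rw [← e]
    refine Finset.sum_congr rfl fun U _ => ?_
    simp only [hd, Finset.sum_filter, Finset.mul_sum]
    refine Finset.sum_congr rfl fun V _ => ?_
    split_ifs <;> ring
  -- Step A: `d W = 0` for every `W ⊆ T`, by induction on `|W|`
  have hA : ∀ n : ℕ, ∀ W ∈ T.powerset, W.card = n → d W = 0 := by
    intro n
    induction n using Nat.strong_induction_on with
    | _ n ih =>
      intro W hW hWn
      have e := hconv W hW
      rw [← Finset.add_sum_erase _ _ (Finset.mem_powerset_self W), Finset.sdiff_self, hb0,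
        one_mul] at e
      have hrest : ∑ U ∈ W.powerset.erase W, b (W \ U) * d U = 0 := by
        refine Finset.sum_eq_zero fun U hU => ?_
        rw [Finset.mem_erase, Finset.mem_powerset] at hU
        have hUT : U ∈ T.powerset :=
          Finset.mem_powerset.mpr (hU.2.trans (Finset.mem_powerset.mp hW))
        have hlt : U.card < n := hWn ▸ Finset.card_lt_card (lt_of_le_of_ne hU.2 hU.1)
        rw [ih U.card hlt U hUT rfl, mul_zero]
      rwa [hrest, add_zero] at e
  -- Step B: `cV V = 0`, by downward induction on `|V|`
  have hB' : ∀ n : ℕ, ∀ V ∈ T.powerset, T.card - V.card = n → cV V = 0 := by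
    intro n
    induction n using Nat.strong_induction_on with
    | _ n ih =>
      intro V hV hVn
      have hdV : d V = 0 := hA V.card V hV rfl
      have hs : ((-1 : ℂ) ^ V.card * (V.card.factorial : ℂ)) ≠ 0 :=
        mul_ne_zero (pow_ne_zero _ (by norm_num)) (by exact_mod_cast V.card.factorial_ne_zero)
      have hsum : ∑ V' ∈ T.powerset with V ⊆ V', cV V' = 0 := by
        simpa [hd, hs] using hdV
      have hVmem : V ∈ T.powerset.filter (fun V' => V ⊆ V') :=
        Finset.mem_filter.mpr ⟨hV, subset_refl V⟩
      rw [← Finset.add_sum_erase _ _ hVmem] at hsum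
      have hrest : ∑ V' ∈ (T.powerset.filter (fun V' => V ⊆ V')).erase V, cV V' = 0 := by
        refine Finset.sum_eq_zero fun V' hV' => ?_
        rw [Finset.mem_erase, Finset.mem_filter] at hV'
        have hlt' : V.card < V'.card :=
          Finset.card_lt_card (lt_of_le_of_ne hV'.2.2 (Ne.symm hV'.1))
        have hle : V'.card ≤ T.card := Finset.card_le_card (Finset.mem_powerset.mp hV'.2.1)
        exact ih (T.card - V'.card) (by omega) V' hV'.2.1 rfl
      rwa [hrest, add_zero] at hsum
  intro V hV
  exact hB' _ V hV rfl

/-! ## 4. Positivity of the full product's coefficients -/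

/-- The `x`-free partition coefficients of `∏_{V ∈ 𝒦} φ_V` are natural numbers, and the one at
`y^W` is `≥ 1` as soon as every singleton `{c}`, `c ∈ W`, is in `𝒦`. -/
theorem coeff_empty_prod_nat (κ : Fin h → Finset (Fin h) → ℂ) (𝒦 : Finset (Finset (Fin h)))
    (W : Finset (Fin h)) :
    ∃ n : ℕ, coeff (∑ a ∈ (∅ : Finset (Fin h)), Finsupp.single (Fin.castAdd h a) 1 +
        ∑ c ∈ W, Finsupp.single (Fin.natAdd h c) 1)
        (∏ V ∈ 𝒦, (C 1 + ∑ a, C (κ a V) * X (Fin.castAdd h a) +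
          ∑ c, C (if c ∈ V then (1 : ℂ) else 0) * X (Fin.natAdd h c))) = (n : ℂ) ∧
      ((∀ c ∈ W, ({c} : Finset (Fin h)) ∈ 𝒦) → 1 ≤ n) := by
  classical
  induction 𝒦 using Finset.induction_on generalizing W with
  | empty =>
    refine ⟨if W = ∅ then 1 else 0, ?_, ?_⟩
    · rw [Finset.prod_empty, coeff_one]
      by_cases hW : W = ∅
      · subst hW; simp
      · have hne : ¬ ((0 : Fin (h + h) →₀ ℕ) = ∑ a ∈ (∅ : Finset (Fin h)), Finsupp.single (Fin.castAdd h a) 1 +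
            ∑ c ∈ W, Finsupp.single (Fin.natAdd h c) 1) := by
          intro e
          have e' := (partitionExpo_eq_iff ∅ ∅ ∅ W).mp (by simpa using e)
          exact hW e'.2.symm
        rw [if_neg hW, if_neg hne]
        simp
    · intro hcond
      by_cases hW : W = ∅
      · simp [hW]
      · obtain ⟨c, hc⟩ := Finset.nonempty_iff_ne_empty.mpr hW
        exact absurd (hcond c hc) (Finset.notMem_empty _)
  | insert V 𝒦 hV ih =>
    choose N hN hN1 using ih
    refine ⟨N W + ∑ c ∈ W with c ∈ V, N (W.erase c), ?_, ?_⟩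
    · rw [Finset.prod_insert hV, mul_comm, coeff_empty_mul_form, hN]
      push_cast
      rw [Finset.sum_congr rfl fun c _ => hN (W.erase c)]
    · intro hcond
      by_cases hall : ∀ c ∈ W, ({c} : Finset (Fin h)) ∈ 𝒦
      · exact le_add_right (hN1 W hall)
      · obtain ⟨c₀, hc₀'⟩ := not_forall.mp hall
        obtain ⟨hc₀W, hc₀⟩ := Classical.not_imp.mp hc₀'
        have hVc : V = {c₀} := by
          rcases Finset.mem_insert.mp (hcond c₀ hc₀W) with e | e
          · exact e.symm
          · exact absurd e hc₀
        have hc₀V : c₀ ∈ V := by rw [hVc]; exact Finset.mem_singleton_self _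
        have hmem : c₀ ∈ W.filter (fun c => c ∈ V) := Finset.mem_filter.mpr ⟨hc₀W, hc₀V⟩
        have h1 : 1 ≤ N (W.erase c₀) := by
          refine hN1 _ fun c hc => ?_
          rw [Finset.mem_erase] at hc
          rcases Finset.mem_insert.mp (hcond c hc.2) with e | e
          · exact absurd (Finset.singleton_injective (e.trans hVc)) hc.1
          · exact e
        exact le_add_left (h1.trans
          (Finset.single_le_sum (f := fun c => N (W.erase c)) (fun _ _ => Nat.zero_le _) hmem))

/-! ## 5. Packaging: embedding the forms into `Fin (h+h)` and the final determinant -/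

/-- Distribute at most `h + h` affine forms (indexed by a Finset `PT`) over the slots `Fin (h + h)`,
padding with the constant form `1` (empty products). -/
theorem exists_forms_of_card_le (PT : Finset (Finset (Fin h))) (hcard : PT.card ≤ h + h)
    (φ : Finset (Fin h) → MvPolynomial (Fin (h + h)) ℂ) (hφ : ∀ V ∈ PT, (φ V).totalDegree ≤ 1) :
    ∃ ℓ : Fin (h + h) → MvPolynomial (Fin (h + h)) ℂ, (∀ k, (ℓ k).totalDegree ≤ 1) ∧
      ∏ k, ℓ k = ∏ V ∈ PT, φ V := by
  classical
  have hc : Fintype.card PT ≤ Fintype.card (Fin (h + h)) := by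
    rw [Fintype.card_coe, Fintype.card_fin]; exact hcard
  obtain ⟨ι⟩ := Function.Embedding.nonempty_of_card_le hc
  refine ⟨fun k => ∏ x ∈ (Finset.univ : Finset PT) with ι x = k, φ (x : Finset (Fin h)), ?_, ?_⟩
  · intro k
    by_cases hk : ∃ x : PT, ι x = k
    · obtain ⟨x, hx⟩ := hk
      have hfil : ((Finset.univ : Finset PT).filter fun x' => ι x' = k) = {x} := by
        ext x'
        simp only [Finset.mem_filter, Finset.mem_univ, true_and, Finset.mem_singleton]
        constructor
        · intro e; exact ι.injective (e.trans hx.symm)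
        · rintro rfl; exact hx
      simp only [hfil, Finset.prod_singleton]
      exact hφ _ x.2
    · have hfil : ((Finset.univ : Finset PT).filter fun x' => ι x' = k) = ∅ := by
        ext x'
        simp only [Finset.mem_filter, Finset.mem_univ, true_and, Finset.notMem_empty, iff_false]
        exact fun e => hk ⟨x', e⟩
      simp only [hfil, Finset.prod_empty, totalDegree_one]
      exact Nat.zero_le _
  · rw [Finset.prod_fiberwise Finset.univ ι (fun x : PT => φ (x : Finset (Fin h)))]
    exact Finset.prod_coe_sort PT φ

/-- Determinant of the identity matrix with one row replaced: `det = ` the diagonal entry of that row. -/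
theorem det_one_updateRow {r : ℕ} (M : Matrix (Fin r) (Fin r) ℂ) (i₀ : Fin r) (b : Fin r → ℂ)
    (hM : ∀ i j, M i j = if i = i₀ then b j else (if i = j then 1 else 0)) : M.det = b i₀ := by
  classical
  have e : M = 1 + Matrix.replicateCol Unit (Pi.single i₀ (1 : ℂ)) *
      Matrix.replicateRow Unit (fun j => b j - (1 : Matrix (Fin r) (Fin r) ℂ) i₀ j) := by
    ext i j
    rw [hM i j, Matrix.add_apply, Matrix.mul_apply]
    simp only [Matrix.replicateCol_apply, Matrix.replicateRow_apply, Finset.univ_unique,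
      Finset.sum_singleton, Matrix.one_apply, Pi.single_apply]
    by_cases hi : i = i₀
    · subst hi; simp
    · simp [hi]
  rw [e, Matrix.det_one_add_replicateCol_mul_replicateRow, dotProduct]
  simp [Pi.single_apply]

end Summit.ValiantsHypothesis.ValiantsHypothesis.Theorems.BarrierLever.ChowSubcube
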